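import Mathlib
import Literature.Probability.LatticeModels.ThermodynamicLimit
import Literature.Probability.LatticeModels.SharpnessProofs
import Summits.CriticalPhenomena.Ising3DConformalLimit.Theorems.PrecisionLaplacianDirectCorrelationStableTailKernelScalingAux3
import HarnessLib

/-!
# Helpers (III) for stub `stub_rieszGaussian` of line `diffusive-branch-is-nonsaturation`
(crux `PrecisionLaplacian.DirectCorrelationStableTail`, item stmt-CriticalPhenomena-4799)

**The error estimate for the subordinated integral.**  After subordination (file (I)) the
Gaussian-regularised Riesz–Fourier integral is `D(u) = κ ∫_0^∞ w_t(s)(1 − e^{-A_s}cos B_s) ds` with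
`A_s = (st/(s+t))|u|₂²`, `B_s = (s/(s+t)) k·u`, and the limit is `κ W₀ (1 − cos k·u)`, `W₀ = ∫ w_0`.
This file proves, for an ABSTRACT nonnegative integrable weight `w` on `(0,∞)` with
`w(s) ≤ L s^{β-1}` and `∫ w ≤ W̄` (registered helper sub-goal `stub_rieszGaussian_auxErrorCore`):

* the core estimate (`rieszG_error_core`)
  `|∫ w(1 − e^{-A}cos B) − W₀(1 − cos θ)| ≤ c₁ L σ^β/β + ((t/σ)c₂ + tρ) W̄ + |1 − cos θ|·|∫ w − W₀|`
  whenever `|cos θ − cos(mθ)| ≤ min(c₁, (1−m)c₂)` on `m ∈ [0,1]` — used with `(c₁,c₂) = (2,|θ|)`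
  (uniform claim) and `(θ²,θ²)` (second-order claim), via the elementary trigonometric bounds
  `rieszG_cos_sub_cos_le_two/lin/sq`;
* the crude bound `|∫ w(1 − e^{-A}cos B)| ≤ 2W̄` (`rieszG_crude_bound`);
* the small-`s` mass `∫_0^σ s^{β-1} ds = σ^β/β` (`rieszG_small_mass`).

Only `import Mathlib` mathematics (plus `kernSc_one_sub_exp_neg_le` of the landed
`…KernelScalingAux3`); all statements are folklore; no definitions are introduced.
-/

noncomputable section

namespace Summit.CriticalPhenomena.Ising3DConformalLimit.Cruxes.DirectCorrelationStableTail.DiffusiveBranchIsNonsaturation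

open MeasureTheory Filter Topology Set
open scoped BigOperators

/-! ### Scalar inequalities -/

/-- The relaxation factor `A_s = (st/(s+t)) ρ` lies in `[0, tρ]` (`s, t > 0`, `ρ ≥ 0`).
[folklore] -/
theorem rieszG_A_bounds {s t ρ : ℝ} (hs : 0 < s) (ht : 0 < t) (hρ : 0 ≤ ρ) :
    0 ≤ s * t / (s + t) * ρ ∧ s * t / (s + t) * ρ ≤ t * ρ := by
  have hst : 0 < s + t := add_pos hs ht
  refine ⟨by positivity, mul_le_mul_of_nonneg_right ?_ hρ⟩
  rw [div_le_iff₀ hst]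
  nlinarith

/-- Pointwise splitting of the error integrand:
`|(1 - e^{-A}cos B) - (1 - cos θ)| ≤ |cos θ - cos B| + |1 - e^{-A}|`. [folklore] -/
theorem rieszG_err_pt (A B θ : ℝ) :
    |(1 - Real.exp (-A) * Real.cos B) - (1 - Real.cos θ)| ≤
      |Real.cos θ - Real.cos B| + |1 - Real.exp (-A)| := by
  have h : (1 - Real.exp (-A) * Real.cos B) - (1 - Real.cos θ) =
      (Real.cos θ - Real.cos B) + (1 - Real.exp (-A)) * Real.cos B := by ring
  rw [h]
  refine (abs_add_le _ _).trans (add_le_add le_rfl ?_)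
  rw [abs_mul]
  exact mul_le_of_le_one_right (abs_nonneg _) (Real.abs_cos_le_one _)

/-- `|cos θ - cos(mθ)| ≤ 2`. [folklore] -/
theorem rieszG_cos_sub_cos_le_two (θ m : ℝ) : |Real.cos θ - Real.cos (m * θ)| ≤ 2 := by
  have h1 := Real.abs_cos_le_one θ
  have h2 := Real.abs_cos_le_one (m * θ)
  calc |Real.cos θ - Real.cos (m * θ)| ≤ |Real.cos θ| + |Real.cos (m * θ)| := abs_sub _ _
    _ ≤ 1 + 1 := add_le_add h1 h2
    _ = 2 := by norm_num

/-- `|cos θ - cos(mθ)| ≤ (1 - m)|θ|` for `m ≤ 1` (`cos` is `1`-Lipschitz). [folklore] -/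
theorem rieszG_cos_sub_cos_le_lin {θ m : ℝ} (hm1 : m ≤ 1) :
    |Real.cos θ - Real.cos (m * θ)| ≤ (1 - m) * |θ| := by
  refine (Real.abs_cos_sub_cos_le _ _).trans (le_of_eq ?_)
  rw [show θ - m * θ = (1 - m) * θ by ring, abs_mul, abs_of_nonneg (by linarith)]

/-- `|cos θ - cos(mθ)| ≤ (1 - m) θ²` for `0 ≤ m ≤ 1` (from
`cos x - cos y = -2 sin((x+y)/2) sin((x-y)/2)` and `|sin z| ≤ |z|`). [folklore] -/
theorem rieszG_cos_sub_cos_le_sq {θ m : ℝ} (hm0 : 0 ≤ m) (hm1 : m ≤ 1) :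
    |Real.cos θ - Real.cos (m * θ)| ≤ (1 - m) * θ ^ 2 := by
  rw [Real.cos_sub_cos, abs_mul, abs_mul, abs_neg, abs_two]
  have h1 : |Real.sin ((θ + m * θ) / 2)| ≤ |(θ + m * θ) / 2| := Real.abs_sin_le_abs
  have h2 : |Real.sin ((θ - m * θ) / 2)| ≤ |(θ - m * θ) / 2| := Real.abs_sin_le_abs
  have e1 : |(θ + m * θ) / 2| = (1 + m) / 2 * |θ| := by
    rw [show (θ + m * θ) / 2 = (1 + m) / 2 * θ by ring, abs_mul, abs_of_nonneg (by linarith)]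
  have e2 : |(θ - m * θ) / 2| = (1 - m) / 2 * |θ| := by
    rw [show (θ - m * θ) / 2 = (1 - m) / 2 * θ by ring, abs_mul, abs_of_nonneg (by linarith)]
  rw [e1] at h1
  rw [e2] at h2
  have hθ : |θ| ^ 2 = θ ^ 2 := sq_abs θ
  calc 2 * |Real.sin ((θ + m * θ) / 2)| * |Real.sin ((θ - m * θ) / 2)|
      ≤ 2 * ((1 + m) / 2 * |θ|) * ((1 - m) / 2 * |θ|) :=
        mul_le_mul (mul_le_mul_of_nonneg_left h1 zero_le_two) h2 (abs_nonneg _) (by positivity)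
    _ = (1 + m) / 2 * ((1 - m) * θ ^ 2) := by rw [← hθ]; ring
    _ ≤ 1 * ((1 - m) * θ ^ 2) := by
        refine mul_le_mul_of_nonneg_right (by linarith) ?_
        exact mul_nonneg (by linarith) (sq_nonneg _)
    _ = (1 - m) * θ ^ 2 := one_mul _

/-! ### Small-`s` mass -/

/-- Small-`s` mass: `∫_0^σ s^{β-1} ds = σ^β/β` (`β, σ > 0`), as an integral over `(0,∞)` of the
indicator of `(0, σ]`, together with its integrability. [folklore] -/
theorem rieszG_small_mass {β : ℝ} (hβ0 : 0 < β) {σ : ℝ} (hσ : 0 < σ) :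
    IntegrableOn (fun s : ℝ => (Ioc 0 σ).indicator (fun s => s ^ (β - 1)) s) (Ioi 0) ∧
    ∫ s in Ioi (0 : ℝ), (Ioc 0 σ).indicator (fun s => s ^ (β - 1)) s = σ ^ β / β := by
  have hr : -1 < β - 1 := by linarith
  have hIoc : IntegrableOn (fun s : ℝ => s ^ (β - 1)) (Ioc 0 σ) :=
    (intervalIntegrable_iff_integrableOn_Ioc_of_le hσ.le).1
      (intervalIntegral.intervalIntegrable_rpow' hr)
  constructor
  · rw [IntegrableOn, integrable_indicator_iff measurableSet_Ioc, IntegrableOn,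
      Measure.restrict_restrict measurableSet_Ioc, Ioc_inter_Ioi, max_self]
    exact hIoc
  · rw [setIntegral_indicator measurableSet_Ioc, inter_eq_right.2 Ioc_subset_Ioi_self,
      ← intervalIntegral.integral_of_le hσ.le, integral_rpow (Or.inl hr),
      Real.zero_rpow (by linarith), sub_zero, show β - 1 + 1 = β by ring]

/-! ### The abstract error estimate -/

/-- **Core error estimate.**  Let `w ≥ 0` be integrable on `(0,∞)` with `w(s) ≤ L s^{β-1}` and
`∫ w ≤ W̄`; let `t > 0`, `ρ ≥ 0`, `σ > 0`, and suppose `|cos θ − cos(mθ)| ≤ c₁` and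
`|cos θ − cos(mθ)| ≤ (1−m) c₂` for all `m ∈ [0,1]`.  Then, with `A_s = (st/(s+t))ρ`,
`B_s = (s/(s+t))θ`,
`|∫ w (1 − e^{-A}cos B) − W₀(1 − cos θ)| ≤ c₁ L σ^β/β + ((t/σ)c₂ + tρ) W̄ + |1 − cos θ| |∫ w − W₀|`
for every real `W₀`: split `(1 − e^{-A}cos B) − (1 − cos θ) = (cos θ − cos B) + (1 − e^{-A})cos B`,
use `|1 − e^{-A}| ≤ A ≤ tρ`, the bound `c₁` and `w ≤ L s^{β-1}` on `s ≤ σ`, and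
`1 − s/(s+t) = t/(s+t) ≤ t/σ` on `s > σ`. [folklore] -/
theorem rieszG_error_core {β L t ρ θ σ c₁ c₂ Wbar W₀ : ℝ} {w : ℝ → ℝ} (hβ0 : 0 < β)
    (hwi : IntegrableOn w (Ioi 0)) (hw0 : ∀ s : ℝ, 0 < s → 0 ≤ w s)
    (hwL : ∀ s : ℝ, 0 < s → w s ≤ L * s ^ (β - 1)) (hW : ∫ s in Ioi (0 : ℝ), w s ≤ Wbar)
    (ht : 0 < t) (hρ : 0 ≤ ρ) (hσ0 : 0 < σ) (hc₁ : 0 ≤ c₁) (hc₂ : 0 ≤ c₂)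
    (h₁ : ∀ m : ℝ, 0 ≤ m → m ≤ 1 → |Real.cos θ - Real.cos (m * θ)| ≤ c₁)
    (h₂ : ∀ m : ℝ, 0 ≤ m → m ≤ 1 → |Real.cos θ - Real.cos (m * θ)| ≤ (1 - m) * c₂) :
    |(∫ s in Ioi (0 : ℝ), w s *
        (1 - Real.exp (-(s * t / (s + t) * ρ)) * Real.cos (s / (s + t) * θ))) -
      W₀ * (1 - Real.cos θ)| ≤
    c₁ * L * (σ ^ β / β) + (t / σ * c₂ + t * ρ) * Wbar +
      |1 - Real.cos θ| * |(∫ s in Ioi (0 : ℝ), w s) - W₀| := by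
  set e : ℝ → ℝ := fun s => (1 - Real.exp (-(s * t / (s + t) * ρ)) * Real.cos (s / (s + t) * θ)) -
    (1 - Real.cos θ) with he
  have hem : Measurable e := by
    simp only [he]
    fun_prop
  -- pointwise bound of the error integrand
  have hept : ∀ s : ℝ, 0 < s →
      |e s| ≤ |Real.cos θ - Real.cos (s / (s + t) * θ)| + t * ρ := fun s hs => by
    have hA := rieszG_A_bounds hs ht hρ
    exact (rieszG_err_pt _ _ _).trans
      (add_le_add le_rfl ((kernSc_one_sub_exp_neg_le hA.1).trans hA.2))
  have hm : ∀ s : ℝ, 0 < s → 0 ≤ s / (s + t) ∧ s / (s + t) ≤ 1 ∧ 1 - s / (s + t) = t / (s + t) :=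
    fun s hs => by
      have hst : 0 < s + t := add_pos hs ht
      refine ⟨by positivity, (div_le_one hst).2 (by linarith), ?_⟩
      field_simp
      ring
  have hpt : ∀ s : ℝ, 0 < s → ‖w s * e s‖ ≤
      c₁ * L * (Ioc 0 σ).indicator (fun s => s ^ (β - 1)) s + (t / σ * c₂ + t * ρ) * w s := by
    intro s hs
    obtain ⟨hm0, hm1, hm2⟩ := hm s hs
    have hst : 0 < s + t := add_pos hs ht
    rw [norm_mul, Real.norm_of_nonneg (hw0 s hs), Real.norm_eq_abs]
    rcases le_or_gt s σ with hsσ | hsσ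
    · have hmem : s ∈ Ioc 0 σ := ⟨hs, hsσ⟩
      rw [indicator_of_mem hmem]
      have hc : |e s| ≤ c₁ + t * ρ := (hept s hs).trans (add_le_add (h₁ _ hm0 hm1) le_rfl)
      calc w s * |e s| ≤ w s * (c₁ + t * ρ) := mul_le_mul_of_nonneg_left hc (hw0 s hs)
        _ = c₁ * w s + t * ρ * w s := by ring
        _ ≤ c₁ * (L * s ^ (β - 1)) + (t * ρ * w s + t / σ * c₂ * w s) :=
            add_le_add (mul_le_mul_of_nonneg_left (hwL s hs) hc₁)
              (le_add_of_nonneg_right (mul_nonneg (by positivity) (hw0 s hs)))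
        _ = c₁ * L * s ^ (β - 1) + (t / σ * c₂ + t * ρ) * w s := by ring
    · rw [indicator_of_notMem (fun h : s ∈ Ioc 0 σ => (not_le.2 hsσ) h.2), mul_zero, zero_add]
      have hc : |Real.cos θ - Real.cos (s / (s + t) * θ)| ≤ t / σ * c₂ := by
        refine (h₂ _ hm0 hm1).trans ?_
        rw [hm2]
        refine mul_le_mul_of_nonneg_right ?_ hc₂
        exact div_le_div_of_nonneg_left ht.le hσ0 (by linarith)
      calc w s * |e s| ≤ w s * (t / σ * c₂ + t * ρ) :=
            mul_le_mul_of_nonneg_left ((hept s hs).trans (add_le_add hc le_rfl)) (hw0 s hs)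
        _ = (t / σ * c₂ + t * ρ) * w s := by ring
  -- integrability
  have hsm := rieszG_small_mass hβ0 hσ0
  have hrhs : IntegrableOn (fun s => c₁ * L * (Ioc 0 σ).indicator (fun s => s ^ (β - 1)) s +
      (t / σ * c₂ + t * ρ) * w s) (Ioi 0) :=
    (hsm.1.const_mul (c₁ * L)).add (hwi.const_mul (t / σ * c₂ + t * ρ))
  have hwe : IntegrableOn (fun s => w s * e s) (Ioi 0) := by
    refine Integrable.mono' hrhs (hwi.aestronglyMeasurable.mul hem.aestronglyMeasurable) ?_
    filter_upwards [ae_restrict_mem measurableSet_Ioi] with s hs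
    exact hpt s hs
  -- splitting `J`
  have hJ : (∫ s in Ioi (0 : ℝ), w s *
      (1 - Real.exp (-(s * t / (s + t) * ρ)) * Real.cos (s / (s + t) * θ))) =
      (∫ s in Ioi (0 : ℝ), w s * e s) + (∫ s in Ioi (0 : ℝ), w s) * (1 - Real.cos θ) := by
    rw [← integral_mul_const, ← integral_add hwe (hwi.mul_const _)]
    refine setIntegral_congr_fun measurableSet_Ioi fun s _ => ?_
    simp only [he]
    ring
  have hbound : ‖∫ s in Ioi (0 : ℝ), w s * e s‖ ≤
      ∫ s in Ioi (0 : ℝ), (c₁ * L * (Ioc 0 σ).indicator (fun s => s ^ (β - 1)) s +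
        (t / σ * c₂ + t * ρ) * w s) := by
    refine norm_integral_le_of_norm_le hrhs ?_
    filter_upwards [ae_restrict_mem measurableSet_Ioi] with s hs
    exact hpt s hs
  rw [integral_add (hsm.1.const_mul (c₁ * L)) (hwi.const_mul (t / σ * c₂ + t * ρ)),
    integral_const_mul, integral_const_mul, hsm.2, Real.norm_eq_abs] at hbound
  have hcoef : 0 ≤ t / σ * c₂ + t * ρ := by positivity
  rw [hJ]
  calc |(∫ s in Ioi (0 : ℝ), w s * e s) + (∫ s in Ioi (0 : ℝ), w s) * (1 - Real.cos θ) -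
        W₀ * (1 - Real.cos θ)|
      = |(∫ s in Ioi (0 : ℝ), w s * e s) +
          (1 - Real.cos θ) * ((∫ s in Ioi (0 : ℝ), w s) - W₀)| := by ring_nf
    _ ≤ |∫ s in Ioi (0 : ℝ), w s * e s| + |(1 - Real.cos θ) * ((∫ s in Ioi (0 : ℝ), w s) - W₀)| :=
        abs_add_le _ _
    _ ≤ c₁ * L * (σ ^ β / β) + (t / σ * c₂ + t * ρ) * Wbar +
          |1 - Real.cos θ| * |(∫ s in Ioi (0 : ℝ), w s) - W₀| := by
        rw [abs_mul]
        refine add_le_add (hbound.trans (add_le_add le_rfl ?_)) le_rfl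
        exact mul_le_mul_of_nonneg_left hW hcoef

/-- **Crude bound:** `|∫ w (1 − e^{-A}cos B)| ≤ 2 W̄` for `w ≥ 0` integrable with `∫ w ≤ W̄`
(`|1 − e^{-A}cos B| ≤ 2` as `A ≥ 0`). [folklore] -/
theorem rieszG_crude_bound {t ρ θ Wbar : ℝ} {w : ℝ → ℝ}
    (hwi : IntegrableOn w (Ioi 0)) (hw0 : ∀ s : ℝ, 0 < s → 0 ≤ w s)
    (hW : ∫ s in Ioi (0 : ℝ), w s ≤ Wbar) (ht : 0 < t) (hρ : 0 ≤ ρ) :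
    |∫ s in Ioi (0 : ℝ), w s *
        (1 - Real.exp (-(s * t / (s + t) * ρ)) * Real.cos (s / (s + t) * θ))| ≤ 2 * Wbar := by
  have hpt : ∀ s : ℝ, 0 < s →
      ‖w s * (1 - Real.exp (-(s * t / (s + t) * ρ)) * Real.cos (s / (s + t) * θ))‖ ≤ 2 * w s := by
    intro s hs
    have hA := rieszG_A_bounds hs ht hρ
    rw [norm_mul, Real.norm_of_nonneg (hw0 s hs), Real.norm_eq_abs, mul_comm]
    refine mul_le_mul_of_nonneg_right ?_ (hw0 s hs)
    have h1 : |Real.exp (-(s * t / (s + t) * ρ)) * Real.cos (s / (s + t) * θ)| ≤ 1 := by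
      rw [abs_mul, Real.abs_exp]
      exact mul_le_one₀ (Real.exp_le_one_iff.2 (by linarith [hA.1])) (abs_nonneg _)
        (Real.abs_cos_le_one _)
    calc |1 - Real.exp (-(s * t / (s + t) * ρ)) * Real.cos (s / (s + t) * θ)|
        ≤ |(1 : ℝ)| + |Real.exp (-(s * t / (s + t) * ρ)) * Real.cos (s / (s + t) * θ)| :=
          abs_sub _ _
      _ ≤ 1 + 1 := by rw [abs_one]; exact add_le_add le_rfl h1
      _ = 2 := by norm_num
  have h := norm_integral_le_of_norm_le (hwi.const_mul 2)
    ((ae_restrict_mem measurableSet_Ioi).mono fun s hs => hpt s hs)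
  rw [integral_const_mul, Real.norm_eq_abs] at h
  exact h.trans (by nlinarith [hW])

/-- **Registered helper sub-goal `stub_rieszGaussian_auxErrorCore`** of stub `stub_rieszGaussian`
(line `diffusive-branch-is-nonsaturation`, crux stmt-CriticalPhenomena-4799): the core error
estimate `rieszG_error_core` and the crude bound `rieszG_crude_bound` for an abstract subordinated
weight.
[folklore] -/
theorem stub_rieszGaussian_auxErrorCore :
    ∀ (β L t ρ θ σ c₁ c₂ Wbar W₀ : ℝ) (w : ℝ → ℝ), 0 < β →
      MeasureTheory.IntegrableOn w (Set.Ioi 0) → (∀ s : ℝ, 0 < s → 0 ≤ w s) →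
      (∀ s : ℝ, 0 < s → w s ≤ L * s ^ (β - 1)) → (∫ s in Set.Ioi (0 : ℝ), w s ≤ Wbar) →
      0 < t → 0 ≤ ρ → 0 < σ → 0 ≤ c₁ → 0 ≤ c₂ →
      (∀ m : ℝ, 0 ≤ m → m ≤ 1 → |Real.cos θ - Real.cos (m * θ)| ≤ c₁) →
      (∀ m : ℝ, 0 ≤ m → m ≤ 1 → |Real.cos θ - Real.cos (m * θ)| ≤ (1 - m) * c₂) →
      |(∫ s in Set.Ioi (0 : ℝ), w s *
          (1 - Real.exp (-(s * t / (s + t) * ρ)) * Real.cos (s / (s + t) * θ))) -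
        W₀ * (1 - Real.cos θ)| ≤
        c₁ * L * (σ ^ β / β) + (t / σ * c₂ + t * ρ) * Wbar +
          |1 - Real.cos θ| * |(∫ s in Set.Ioi (0 : ℝ), w s) - W₀| ∧
      |∫ s in Set.Ioi (0 : ℝ), w s *
          (1 - Real.exp (-(s * t / (s + t) * ρ)) * Real.cos (s / (s + t) * θ))| ≤ 2 * Wbar :=
  fun _β _L _t _ρ _θ _σ _c₁ _c₂ _Wbar _W₀ _w hβ0 hwi hw0 hwL hW ht hρ hσ0 hc₁ hc₂ h₁ h₂ =>
    ⟨rieszG_error_core hβ0 hwi hw0 hwL hW ht hρ hσ0 hc₁ hc₂ h₁ h₂,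
      rieszG_crude_bound hwi hw0 hW ht hρ⟩

end Summit.CriticalPhenomena.Ising3DConformalLimit.Cruxes.DirectCorrelationStableTail.DiffusiveBranchIsNonsaturation

end
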